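import Mathlib
import Summits.MatrixMultiplication.MatrixMultiplication.Theorems.LevelGradedCohnUmansLieRankDesignsStubBudgetGlue
import Summits.MatrixMultiplication.MatrixMultiplication.Theorems.LevelGradedCohnUmansLieRankDesignsStubLevelFixedVector
import Summits.MatrixMultiplication.MatrixMultiplication.Theorems.LevelGradedCohnUmansLieRankDesignsStubParabolicFacts
import Summits.MatrixMultiplication.MatrixMultiplication.Theorems.LevelGradedCohnUmansLieRankDesignsStubOrbitSpanBound
import Summits.MatrixMultiplication.MatrixMultiplication.Theorems.LevelGradedCohnUmansLieRankDesignsStubRegularCount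
import Summits.MatrixMultiplication.MatrixMultiplication.Theorems.LevelGradedCohnUmansLieRankDesignsStubCentralDegreeBound

/-!
# `LieRankDesigns` (stmt-MatrixMultiplication-7614), line `fixed-rank-universality-gl2-level-one`: stub C `stub_levelOneBudget` — the level-one cell budget

Crux `Summit.MatrixMultiplication.MatrixMultiplication.Theses.LevelGradedCohnUmans.LieRankDesigns`; skeleton
`Cruxes/LieRankDesigns/Lines/fixed_rank_universality_gl2_level_one.lean` (lead
prover-line-stmt-MatrixMultiplication-7614-c1, 4 registered stubs A–D); this file proves the registered
stub `stub_levelOneBudget` verbatim (name + signature) and lands `--supports stmt-MatrixMultiplication-7614`.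

Content. For every prime `p`, rank `m ≥ 1` and real `s ≥ 2`:
`budget p m 1 s · (p-1)^{(s-2)/2} ≤ 2^{m(s-1)} · p^{(m-1/2)s}`, where
`budget p m k s = Σ_{χ ∈ Irr(GL_m(𝔽_p)) ∩ F_k} χ(1)^s` is the graded budget of
`Theorems.LieRankDesigns.Negative.Basics`.  This is the `k = 1` slice of the landed `CellBudget`
`budget p m k s · (p-1)^{(s-2)/2} ≤ 2^{m(s-1)} p^{(mk - k²/2)s}` (`1 ≤ k ≤ m`, `s ≥ 2`), i.e. of
`stub_budgetGlue` (stub F of line `Sketch`) fed with the landed stubs `stub_levelFixedVector` (A),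
`stub_parabolicFacts` (B), `stub_orbitSpanBound` (C), `stub_regularCount` (D) and
`stub_centralDegreeBound` (E) of that line; at `k = 1` the exponent `m·k - k²/2` is `m - 1/2`
(`Nat.cast_one`, `mul_one`, `one_pow`).
-/

set_option linter.dupNamespace false

noncomputable section

open scoped BigOperators
open Literature.RepresentationTheory.FiniteGroups
open Summit.MatrixMultiplication.MatrixMultiplication.Theorems.LieRankDesigns.Negative
  (GLm Mat fourierFn RankSupp RankSep levelSet budget volume)

namespace Summit.MatrixMultiplication.MatrixMultiplication.Theorems.LieRankDesigns

/-- **`CellBudget` holds in every cell** `1 ≤ k ≤ m`, `s ≥ 2`: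
`budget p m k s · (p-1)^{(s-2)/2} ≤ 2^{m(s-1)} · p^{(mk - k²/2)s}` — the glue `stub_budgetGlue` (F)
applied to the landed stubs A–E of line `Sketch`. -/
theorem cellBudget_of_stubs :
    ∀ (p m k : ℕ) [Fact p.Prime], 1 ≤ k → k ≤ m → ∀ s : ℝ, 2 ≤ s →
      budget p m k s * ((p : ℝ) - 1) ^ ((s - 2) / 2) ≤
        2 ^ ((m : ℝ) * (s - 1)) * (p : ℝ) ^ (((m : ℝ) * k - (k : ℝ) ^ 2 / 2) * s) :=
  stub_budgetGlue stub_levelFixedVector stub_parabolicFacts stub_orbitSpanBound stub_regularCount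
    stub_centralDegreeBound

/-- **Stub C `LevelOneBudget`** (registered signature): for every prime `p`, every rank `m ≥ 1` and
every real `s ≥ 2`, `budget p m 1 s · (p-1)^{(s-2)/2} ≤ 2^{m(s-1)} · p^{(m-1/2)s}` — the `k = 1`
slice of `cellBudget_of_stubs` (the exponent `m·1 - 1²/2 = m - 1/2`). -/
theorem stub_levelOneBudget :
    ∀ (p m : ℕ) [Fact p.Prime], 1 ≤ m → ∀ s : ℝ, 2 ≤ s →
      budget p m 1 s * ((p : ℝ) - 1) ^ ((s - 2) / 2) ≤
        2 ^ ((m : ℝ) * (s - 1)) * (p : ℝ) ^ (((m : ℝ) - 1 / 2) * s) := by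
  intro p m _ hm s hs
  have h := cellBudget_of_stubs p m 1 le_rfl hm s hs
  simp only [Nat.cast_one, mul_one, one_pow] at h
  exact h

end Summit.MatrixMultiplication.MatrixMultiplication.Theorems.LieRankDesigns

end
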